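import Summits.ResolutionOfSingularities.ResolutionOfSingularities.Theorems.FrobeniusLadderFInjectiveMacaulayficationBlowupFiModelOfCover
import Summits.ResolutionOfSingularities.ResolutionOfSingularities.Theorems.FrobeniusLadderFInjectiveMacaulayficationGradedChartDescent
import Literature.AlgebraicGeometry.Resolution.AffineBlowupResolutionCriterion
import Mathlib.RingTheory.Jacobson.Ring
import HarnessLib

/-!
# E6‴ over an OPEN `D(h)`: the blow-up glue for a sub-cover of charts, restricted to a basic open set of the base
# (crux `FInjectiveMacaulayfication` stmt-ResolutionOfSingularities-15315, chain w45a; ticket M2 «open-restricted engine», R12.2 (iii))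

[OURS · L1 W4.5a · res-L1-w45a-lead-1 gen 4] Support file (`--supports stmt-ResolutionOfSingularities-15315 --as helper`) for the
crux `FrobeniusLadder.FInjectiveMacaulayfication`; NOT a statement of any manuscript; AI-written, weaker than expert review.

E6‴ (`BlowupFiModelOfCover.stub_blowupFiModelOfCover`) certifies the blow-up `Bl_I(Spec R)` at EVERY stalk from (a) the clause of
`R_P` at every prime `P ⊉ I` and (b) the chart clause at the maximal ideals of the affine blow-up algebras `R[I/vⱼ]` lying on the
exceptional divisor. For STRONG⁺/closed-locus steps along a stratum that meets ANOTHER bad locus (the f_cusp/𝔽₃ road, move 2: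
the `Γ`-lines meet the bad curve `C̃′`), hypothesis (a) is false globally but true on an open `D(h)`. This file proves the
OPEN-RESTRICTED glue: with (a) asked only at primes `P ⊉ I` with `h ∉ P` and (b) only at exceptional maximal ideals NOT
containing `h/1`, every stalk of `Bl_I(Spec R)` at a point lying over `D(h)` is a domain satisfying the Cohen–Macaulay +
Frobenius-closed clause (`blowupClause_over_basicOpen`). The one new ingredient w.r.t. E6‴: the maximal ideal above the chart
prime of the point is chosen MISSING `h/1`, which is possible because the chart ring `(R[It])_{(vⱼt)} ≅ R[I/vⱼ]` is a finitely
generated algebra over the Jacobson ring `R` (`GradedChartDescent.finiteType_blowupAlgebra`, Mathlib `isJacobsonRing_of_finiteType`,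
`isJacobsonRing_iso`), hence Jacobson (`exists_isMaximal_le_notMem`). «Over `D(h)`» is read through
`affineBlowup.π_awayι_reesT_apply` (the chart point `q` maps to `q ∩ R`). Hypothesis added w.r.t. E6‴: `IsJacobsonRing R`
(true for every algebra of finite type over a field).
-/

-- single-problem summit: the doubled namespace component is forced
set_option linter.dupNamespace false

noncomputable section

namespace Summit.ResolutionOfSingularities.ResolutionOfSingularities.Theorems.FInjectiveMacaulayfication.BlowupFiModelOfCoverOpen

open AlgebraicGeometry CategoryTheory Literature.AlgebraicGeometry.Resolution
open Summit.ResolutionOfSingularities.ResolutionOfSingularities.Theorems.FInjectiveMacaulayfication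

/-! ## §1 The Jacobson choice of a maximal ideal -/

/-- **Jacobson choice**: in a Jacobson ring, a prime `q` not containing `u` lies in a maximal ideal not containing `u`
(`q` is the intersection of the maximal ideals above it). [folklore] -/
theorem exists_isMaximal_le_notMem {A : Type*} [CommRing A] [IsJacobsonRing A] (q : Ideal A) [q.IsPrime] {u : A}
    (hu : u ∉ q) : ∃ M : Ideal A, M.IsMaximal ∧ q ≤ M ∧ u ∉ M := by
  by_contra hcon
  push Not at hcon
  apply hu
  have hJ : q.jacobson = q := IsJacobsonRing.out inferInstance (Ideal.IsPrime.isRadical ‹_›)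
  rw [← hJ, Ideal.jacobson, Ideal.mem_sInf]
  rintro M ⟨hqM, hM⟩
  exact hcon M hM hqM

/-- **The chart ring `(R[It])_{(at)}` is Jacobson** when `R` is Noetherian and Jacobson: it is isomorphic (`reesChartEquiv`) to the
affine blow-up algebra `R[I/a]`, an `R`-algebra of finite type (`GradedChartDescent.finiteType_blowupAlgebra`). [folklore] -/
theorem isJacobsonRing_away {R : Type} [CommRing R] [IsNoetherianRing R] [IsJacobsonRing R] (I : Ideal R) (a : R)
    (ha : a ∈ I) : IsJacobsonRing (HomogeneousLocalization.Away (reesGrading I) (reesT a ha)) := by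
  haveI : Algebra.FiniteType R (blowupAlgebra I a) :=
    GradedChartDescent.finiteType_blowupAlgebra I (IsNoetherian.noetherian I) a
  haveI : IsJacobsonRing (blowupAlgebra I a) := isJacobsonRing_of_finiteType (A := R)
  exact (isJacobsonRing_iso (reesChartEquiv a ha)).mpr inferInstance

/-! ## §2 The chart clause at a prime missing `h/1`, open-restricted hypotheses -/

/-- **The chart clause at every prime of `(R[It])_{(at)}` missing `h/1`**, from: the clause of `R_P` at primes `P ∌ a, h`
(off the exceptional divisor, over `D(h)`), and the chart clause at the maximal ideals containing `a/1` and missing `h/1` (on the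
exceptional divisor, over `D(h)`). The maximal ideal above the given prime is chosen missing `h/1` (Jacobson), then E6′'s case
split (`BlowupFiModel.nonempty_ringEquiv_offExceptional` off the divisor) and localisation of the clause to the smaller prime
(`ClauseOfMaximal.fiClause_atPrime_of_le`). [folklore] -/
theorem chart_fiClause_of_maximal_open (p : ℕ) [Fact p.Prime] {R : Type} [CommRing R] [IsDomain R] [IsNoetherianRing R]
    [IsJacobsonRing R] [CharP R p] {I : Ideal R} (a : R) (ha : a ∈ I) (ha0 : a ≠ 0) (h : R)
    (hoff : ∀ (P : Ideal R) [P.IsPrime], a ∉ P → h ∉ P →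
      IsDomain (Localization.AtPrime P) ∧
      ∀ d : ℕ, ringKrullDim (Localization.AtPrime P) = d → ∀ s : Fin d → Localization.AtPrime P,
        (Ideal.span (Set.range s)).radical.IsMaximal →
          RingTheory.Sequence.IsWeaklyRegular (Localization.AtPrime P) (List.ofFn s) ∧
          ∀ y : Localization.AtPrime P, (∃ e : ℕ, y ^ p ^ e ∈ Ideal.span
            ((fun z : Localization.AtPrime P => z ^ p ^ e) ''
              (Ideal.span (Set.range s) : Set (Localization.AtPrime P)))) → y ∈ Ideal.span (Set.range s))
    (hon : ∀ (Q : Ideal (HomogeneousLocalization.Away (reesGrading I) (reesT a ha))) [Q.IsMaximal],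
      reesChartBase (I := I) a ha a ∈ Q → reesChartBase (I := I) a ha h ∉ Q →
      ∀ d : ℕ, ringKrullDim (Localization.AtPrime Q) = d → ∀ s : Fin d → Localization.AtPrime Q,
        (Ideal.span (Set.range s)).radical.IsMaximal →
          RingTheory.Sequence.IsWeaklyRegular (Localization.AtPrime Q) (List.ofFn s) ∧
          ∀ y : Localization.AtPrime Q, (∃ e : ℕ, y ^ p ^ e ∈ Ideal.span
            ((fun z : Localization.AtPrime Q => z ^ p ^ e) ''
              (Ideal.span (Set.range s) : Set (Localization.AtPrime Q)))) → y ∈ Ideal.span (Set.range s))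
    (q : Ideal (HomogeneousLocalization.Away (reesGrading I) (reesT a ha))) [q.IsPrime]
    (hq : reesChartBase (I := I) a ha h ∉ q) :
    IsDomain (Localization.AtPrime q) ∧
      ∀ d : ℕ, ringKrullDim (Localization.AtPrime q) = d → ∀ s : Fin d → Localization.AtPrime q,
        (Ideal.span (Set.range s)).radical.IsMaximal →
          RingTheory.Sequence.IsWeaklyRegular (Localization.AtPrime q) (List.ofFn s) ∧
          ∀ y : Localization.AtPrime q, (∃ e : ℕ, y ^ p ^ e ∈ Ideal.span
            ((fun z : Localization.AtPrime q => z ^ p ^ e) ''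
              (Ideal.span (Set.range s) : Set (Localization.AtPrime q)))) → y ∈ Ideal.span (Set.range s) := by
  obtain ⟨hnoeth, hdom, hchar⟩ := ReesChartRing.stub_reesChartRing p R I a ha ha0
  haveI := isJacobsonRing_away I a ha
  obtain ⟨Q, hQmax, hqQ, hhQ⟩ := exists_isMaximal_le_notMem q hq
  refine ClauseOfMaximal.fiClause_atPrime_of_le p hqQ ?_
  by_cases huQ : reesChartBase (I := I) a ha a ∈ Q
  · exact ⟨inferInstance, hon Q huQ hhQ⟩
  · obtain ⟨e⟩ := BlowupFiModel.nonempty_ringEquiv_offExceptional a ha Q huQ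
    have haP : a ∉ Ideal.comap (reesChartBase (I := I) a ha) Q := fun h' => huQ (Ideal.mem_comap.mp h')
    have hhP : h ∉ Ideal.comap (reesChartBase (I := I) a ha) Q := fun h' => hhQ (Ideal.mem_comap.mp h')
    obtain ⟨-, hP⟩ := hoff (Ideal.comap (reesChartBase (I := I) a ha) Q) haP hhP
    exact ⟨inferInstance, DegreeZeroDescent.inlineClause_of_ringEquiv p e.symm hP⟩

/-- Transport of the open-restricted chart clause along `(R[It])_{(at)} ≅ R[I/a]` (`reesChartEquiv`): hypotheses stated on the
image model `R[I/a] = blowupAlgebra I a` (maximal ideals containing `a/1` and missing `h/1`) give the chart-ring form used by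
`chart_fiClause_of_maximal_open` (E6‴'s `chartClause_of_blowupAlgebraClause` with the extra `h`). [folklore] -/
theorem chartClause_of_blowupAlgebraClause_open (p : ℕ) {R : Type} [CommRing R] {I : Ideal R} (a : R) (ha : a ∈ I) (h : R)
    (hon : ∀ (Q : Ideal (blowupAlgebra I a)) [Q.IsMaximal], algebraMap R (blowupAlgebra I a) a ∈ Q →
      algebraMap R (blowupAlgebra I a) h ∉ Q →
      ∀ d : ℕ, ringKrullDim (Localization.AtPrime Q) = d → ∀ s : Fin d → Localization.AtPrime Q,
        (Ideal.span (Set.range s)).radical.IsMaximal →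
          RingTheory.Sequence.IsWeaklyRegular (Localization.AtPrime Q) (List.ofFn s) ∧
          ∀ y : Localization.AtPrime Q, (∃ e : ℕ, y ^ p ^ e ∈ Ideal.span
            ((fun z : Localization.AtPrime Q => z ^ p ^ e) ''
              (Ideal.span (Set.range s) : Set (Localization.AtPrime Q)))) → y ∈ Ideal.span (Set.range s))
    (Q : Ideal (HomogeneousLocalization.Away (reesGrading I) (reesT a ha))) [Q.IsMaximal]
    (haQ : reesChartBase (I := I) a ha a ∈ Q) (hhQ : reesChartBase (I := I) a ha h ∉ Q) :
    ∀ d : ℕ, ringKrullDim (Localization.AtPrime Q) = d → ∀ s : Fin d → Localization.AtPrime Q,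
      (Ideal.span (Set.range s)).radical.IsMaximal →
        RingTheory.Sequence.IsWeaklyRegular (Localization.AtPrime Q) (List.ofFn s) ∧
        ∀ y : Localization.AtPrime Q, (∃ e : ℕ, y ^ p ^ e ∈ Ideal.span
          ((fun z : Localization.AtPrime Q => z ^ p ^ e) ''
            (Ideal.span (Set.range s) : Set (Localization.AtPrime Q)))) → y ∈ Ideal.span (Set.range s) := by
  have hmem : algebraMap R (blowupAlgebra I a) a ∈ Q.map (reesChartEquiv a ha) := by
    rw [← reesChartEquiv_reesChartBase a ha a, Ideal.apply_mem_of_equiv_iff]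
    exact haQ
  have hnot : algebraMap R (blowupAlgebra I a) h ∉ Q.map (reesChartEquiv a ha) := by
    rw [← reesChartEquiv_reesChartBase a ha h, Ideal.apply_mem_of_equiv_iff]
    exact hhQ
  have hQ' := hon (Q.map (reesChartEquiv a ha)) hmem hnot
  obtain ⟨eL⟩ := BlowupFiModelOfCover.nonempty_ringEquiv_localization_of_ringEquiv (reesChartEquiv a ha) Q
    (Q.map (reesChartEquiv a ha)) fun x => Ideal.apply_mem_of_equiv_iff
  exact DegreeZeroDescent.inlineClause_of_ringEquiv p eL.symm hQ'

/-! ## §3 The open-restricted glue -/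

/-- **E6‴ OVER `D(h)` — THE OPEN-RESTRICTED BLOW-UP GLUE.** `R` a Noetherian Jacobson domain of characteristic `p`,
`v₁,…,v_t ∈ I` non-zero with `R[It]₊ ⊆ √(v₁t,…,v_tt)` (the charts `D₊(vⱼt)` cover `Bl_I`), `h ∈ R`. If `R_P` satisfies the full
clause at every prime `P ⊉ I` with `h ∉ P`, and every affine blow-up algebra `R[I/vⱼ]` satisfies the Cohen–Macaulay +
Frobenius-closed clause at its maximal ideals containing `vⱼ/1` and NOT containing `h/1`, then EVERY STALK OF `Bl_I(Spec R)` AT A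
POINT OVER `D(h)` is a domain satisfying the clause. (`Bl_I(Spec R) = affineBlowup I → Spec R` is proper and, for `I ≠ 0`,
birational — `affineBlowup.isBirational` — independently of `h`.) [cite: StacksProject, Tag 0804] -/
theorem blowupClause_over_basicOpen (p : ℕ) [Fact p.Prime] (R : Type) [CommRing R] [IsDomain R] [IsNoetherianRing R]
    [IsJacobsonRing R] [CharP R p] (I : Ideal R) (t : ℕ) (v : Fin t → R) (hv : ∀ j : Fin t, v j ∈ I)
    (hv0 : ∀ j : Fin t, v j ≠ 0)
    (hcov : (HomogeneousIdeal.irrelevant (reesGrading I)).toIdeal ≤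
      (Ideal.span (Set.range fun j : Fin t => reesT (I := I) (v j) (hv j))).radical)
    (h : R)
    (hoff : ∀ (P : Ideal R) [P.IsPrime], ¬ I ≤ P → h ∉ P →
      IsDomain (Localization.AtPrime P) ∧
      ∀ d : ℕ, ringKrullDim (Localization.AtPrime P) = d → ∀ s : Fin d → Localization.AtPrime P,
        (Ideal.span (Set.range s)).radical.IsMaximal →
          RingTheory.Sequence.IsWeaklyRegular (Localization.AtPrime P) (List.ofFn s) ∧
          ∀ y : Localization.AtPrime P, (∃ e : ℕ, y ^ p ^ e ∈ Ideal.span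
            ((fun z : Localization.AtPrime P => z ^ p ^ e) ''
              (Ideal.span (Set.range s) : Set (Localization.AtPrime P)))) → y ∈ Ideal.span (Set.range s))
    (hon : ∀ (j : Fin t) (Q : Ideal (Literature.AlgebraicGeometry.Resolution.blowupAlgebra I (v j))) [Q.IsMaximal],
      algebraMap R (Literature.AlgebraicGeometry.Resolution.blowupAlgebra I (v j)) (v j) ∈ Q →
      algebraMap R (Literature.AlgebraicGeometry.Resolution.blowupAlgebra I (v j)) h ∉ Q →
      ∀ d : ℕ, ringKrullDim (Localization.AtPrime Q) = d → ∀ s : Fin d → Localization.AtPrime Q,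
        (Ideal.span (Set.range s)).radical.IsMaximal →
          RingTheory.Sequence.IsWeaklyRegular (Localization.AtPrime Q) (List.ofFn s) ∧
          ∀ y : Localization.AtPrime Q, (∃ e : ℕ, y ^ p ^ e ∈ Ideal.span
            ((fun z : Localization.AtPrime Q => z ^ p ^ e) ''
              (Ideal.span (Set.range s) : Set (Localization.AtPrime Q)))) → y ∈ Ideal.span (Set.range s))
    (y : ↥(affineBlowup I)) (hy : (affineBlowup.π I).base y ∈ PrimeSpectrum.basicOpen h) :
    IsDomain ((affineBlowup I).presheaf.stalk y) ∧ ∀ d : ℕ, ringKrullDim ((affineBlowup I).presheaf.stalk y) = d →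
      ∀ s : Fin d → (affineBlowup I).presheaf.stalk y, (Ideal.span (Set.range s)).radical.IsMaximal →
        RingTheory.Sequence.IsWeaklyRegular ((affineBlowup I).presheaf.stalk y) (List.ofFn s) ∧
        ∀ z : (affineBlowup I).presheaf.stalk y, (∃ e : ℕ, z ^ p ^ e ∈
            Ideal.span ((fun w : (affineBlowup I).presheaf.stalk y => w ^ p ^ e) ''
              (Ideal.span (Set.range s) : Set ((affineBlowup I).presheaf.stalk y)))) →
          z ∈ Ideal.span (Set.range s) := by
  -- the point lies in some chart `D₊(vⱼt)`; write it as `awayι q`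
  obtain ⟨j, hj⟩ := BlowupFiModelOfCover.exists_mem_basicOpen_of_irrelevant_le_radical v hv hcov y
  rw [← Proj.opensRange_awayι (reesGrading I) (reesT (v j) (hv j)) (reesT_mem (v j) (hv j)) Nat.one_pos] at hj
  obtain ⟨q, rfl⟩ := Scheme.Hom.mem_opensRange.mp hj
  -- the stalk is the local ring of the chart ring at `q`
  have e : ((affineBlowup I).presheaf.stalk
      (Proj.awayι (reesGrading I) (reesT (v j) (hv j)) (reesT_mem (v j) (hv j)) Nat.one_pos q)) ≃+*
        Localization.AtPrime q.asIdeal :=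
    ((asIso ((Proj.awayι (reesGrading I) (reesT (v j) (hv j)) (reesT_mem (v j) (hv j))
      Nat.one_pos).stalkMap q)).commRingCatIsoToRingEquiv).trans
      (Spec.stalkIso (.of (HomogeneousLocalization.Away (reesGrading I) (reesT (v j) (hv j)))) q
        ).commRingCatIsoToRingEquiv
  -- `q` lies over `D(h)`: `h/1 ∉ q`
  have hq : reesChartBase (I := I) (v j) (hv j) h ∉ q.asIdeal := by
    have h1 : affineBlowup.π I (Proj.awayι (reesGrading I) (reesT (v j) (hv j)) (reesT_mem (v j) (hv j)) Nat.one_pos q) ∈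
        PrimeSpectrum.basicOpen h := hy
    rw [affineBlowup.π_awayι_reesT_apply] at h1
    exact h1
  -- the open-restricted chart clause at `q`
  have hoff' : ∀ (P : Ideal R) [P.IsPrime], v j ∉ P → h ∉ P →
      IsDomain (Localization.AtPrime P) ∧
      ∀ d : ℕ, ringKrullDim (Localization.AtPrime P) = d → ∀ s : Fin d → Localization.AtPrime P,
        (Ideal.span (Set.range s)).radical.IsMaximal →
          RingTheory.Sequence.IsWeaklyRegular (Localization.AtPrime P) (List.ofFn s) ∧
          ∀ y : Localization.AtPrime P, (∃ e : ℕ, y ^ p ^ e ∈ Ideal.span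
            ((fun z : Localization.AtPrime P => z ^ p ^ e) ''
              (Ideal.span (Set.range s) : Set (Localization.AtPrime P)))) → y ∈ Ideal.span (Set.range s) :=
    fun P _ hxP hhP => hoff P (fun hle => hxP (hle (hv j))) hhP
  obtain ⟨hdom, hcl⟩ := chart_fiClause_of_maximal_open p (v j) (hv j) (hv0 j) h hoff'
    (fun Q _ haQ hhQ => chartClause_of_blowupAlgebraClause_open p (v j) (hv j) h (hon j) Q haQ hhQ) q.asIdeal hq
  haveI := hdom
  exact ⟨MulEquiv.isDomain (Localization.AtPrime q.asIdeal) e.toMulEquiv,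
    DegreeZeroDescent.inlineClause_of_ringEquiv p e.symm hcl⟩

end Summit.ResolutionOfSingularities.ResolutionOfSingularities.Theorems.FInjectiveMacaulayfication.BlowupFiModelOfCoverOpen

end
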